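import Mathlib
import HarnessLib
import Summits.HubbardSuperconductivity.HubbardSuperconductivity.Theorems.KLProgrammeKLRegimeFlowReadResidueSplit
import Summits.HubbardSuperconductivity.HubbardSuperconductivity.Theorems.KLProgrammeKLRegimeTwoLegReadJetDefs

/-!
# Route `KLProgramme`, crux K3 — engine-flow child (stmt-HubbardSuperconductivity-20437 `KLRegimeEngineV17F2`), stub (C) `stub_twoLeg_curvature`,
# located item #20, cure (δ) «(C)-LAST-THERMAL» (pen (R111)): the «SWAP» RE-BRACKETING of the reading step — slice increment in the OLD frame,
# frame response at the NEW scale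

Cell gate-hubbard-kl, seat p2 g17.  The standard step of stub (C) (c4a-1's assembly + `…FlowReadResidueSplit`, p533029 / p598604) writes
`ν_{n+1}(K₀ ⊖ p) = δ_{n+1}(K₀ ⊖ p) + [(B)_n + (C2)_n + (C1)_n]`: the slice increment at the NEW frame plus the scale-`n` residue.  At the LAST index
`n + 1 = N = n_β + 1` the scale-`n_β` frame response (B)_{n_β} is located item #20.  The cure (δ) swaps the order (memo HOME/p2-g17/LAST-THERMAL-SIZING-p2g17.md §1):

  `ν_{n+1}(K₀ ⊖ p)(θ) = δ_{n+1}(K₀)(θ)`                                                        — (A′) slice increment at the OLD frame, on ITS curve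
                     `+ [S_{n+1}(K₀ ⊖ p) − S_{n+1}(K₀)](k_F^{K₀} θ)`                                — (R) frame RESPONSE AT THE NEW SCALE, read on the OLD curve
                     `+ [F(k_F^{K₀⊖p} θ) − F(k_F^{K₀} θ)]`,  `F := ν̃_{n+1}(K₀ ⊖ p) + p`               — (T) transport of the NEW cumulative symbol (+ the piece)
                     `+ [ν_n(K₀)(θ) − p(k_F^{K₀⊖p} θ)]`                                            — (C1) VERBATIM the Jackson-remainder bracket of p598604

(`S_m(K) := symInterp L (klLocSelfEnergyRe … K m − K∘p_·)` the K-separated symbol, `ν̃_m(K) := symInterp L (klLocSelfEnergyRe … K m)`; pure linearity of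
the interpolant + exact reproduction of the piece `p`, degree `≤ L/2`).  At `n + 1 = N` the bracket (R) is EXACT dressing of the native symbol
(`…EngineLastStepFrameIdentity`: the mismatch defect vanishes identically below the thermal layer), (T) is the (C2) door `transport_jets_of_frameOK_fun`
on the generic `C⁵` symbol `F`, (A′) is c4a-1's `TwoLegCurveJetBound … K₀ (n+1)` at the OLD frame, (C1) is unchanged.

* §1 `klLocalPart_succ_eq_swap` (generic frames, guard `p.degree ≤ L/2`), `degree_klFlowPiece_le_half`, `klLocalPart_flow_succ_eq_swap` (flow instance under
  the volume guard `4·klFlowDeg (n+1) ≤ L`);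
* §2 `readLast_jets_of_swap` — jets: (A′) as `TwoLegCurveJetBound … cA cA′ … K₀ (n+1)` + the three brackets `C⁴` with `|∂_θ^k| ≤ R k, T k, J k` ⟹
  `θ ↦ ν_{n+1}(K₀ ⊖ p)(θ)` is `C⁴` with `|∂_θ^k| ≤ curveJetBar cA cA′ U k (n+1) + R k + T k + J k`; `readLast_flow_jets_of_swap` (flow frames, `curveJetBar`
  tables ⟹ `TwoLegReadJetBound … (cA+eR+eT+eJ) (cA′+eR′+eT′+eJ′) … K_{n+1} (n+1)`); `readLast_structured_of_swap` (structured values add).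

Identities + `iteratedDeriv_add` bookkeeping only; nothing about the model's sizes is asserted; nothing asserts superconductivity.
References: BGM 2006 §2.2 (2.23), §2.4 (2.36) [cite: BenfattoGiulianiMastropietro2006].
-/

noncomputable section

namespace Summit.HubbardSuperconductivity.HubbardSuperconductivity.Theorems.KLRegimeSplit

set_option linter.dupNamespace false -- summit = problem name (single-conjunct summit), D-0017

open Real Literature.MathematicalPhysics.QuantumLattice Literature.Probability.LatticeModels
open Literature.MathematicalPhysics.QuantumLattice.FermiRG

section Model

variable {L M : ℕ} [NeZero L] [NeZero M]

/-! ## §1 The swap identity -/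

/-- **THE «SWAP» RE-BRACKETING** (generic frames `K₀`, `K₀ ⊖ p`, piece of degree `≤ L/2`):
`ν_{n+1}(K₀ ⊖ p)(θ) = δ_{n+1}(K₀)(θ) + (R)(θ) + (T)(θ) + (C1)(θ)` with the four brackets of the module docstring. -/
theorem klLocalPart_succ_eq_swap (β U μ : ℝ) {K₀ p : TrigPolyC4v} (hp : p.degree ≤ L / 2) (n : ℕ) (θ : ℝ) :
    klLocalPart L M β U μ (fsub K₀ p) (n + 1) θ =
      klTwoLegCurveProfile L M β U μ K₀ (n + 1) θ +
      ((symInterp L (fun k => klLocSelfEnergyRe L M β U μ (fsub K₀ p) (n + 1) k - (fsub K₀ p).eval (latticeMomentum L k))).eval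
            (klFermiPoint μ K₀ θ) -
        (symInterp L (fun k => klLocSelfEnergyRe L M β U μ K₀ (n + 1) k - K₀.eval (latticeMomentum L k))).eval (klFermiPoint μ K₀ θ)) +
      (((symInterp L (klLocSelfEnergyRe L M β U μ (fsub K₀ p) (n + 1))).eval (klFermiPoint μ (fsub K₀ p) θ) +
            p.eval (klFermiPoint μ (fsub K₀ p) θ)) -
        ((symInterp L (klLocSelfEnergyRe L M β U μ (fsub K₀ p) (n + 1))).eval (klFermiPoint μ K₀ θ) + p.eval (klFermiPoint μ K₀ θ))) +
      (klLocalPart L M β U μ K₀ n θ - p.eval (klFermiPoint μ (fsub K₀ p) θ)) := by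
  -- the (R) bracket in terms of the cumulative interpolants and the piece
  have hfs : (fun k : TorusSite 2 L => (fsub K₀ p).eval (latticeMomentum L k)) =
      fun k => K₀.eval (latticeMomentum L k) - p.eval (latticeMomentum L k) := funext fun k => eval_fsub K₀ p _
  have hR : (symInterp L (fun k => klLocSelfEnergyRe L M β U μ (fsub K₀ p) (n + 1) k - (fsub K₀ p).eval (latticeMomentum L k))).eval
        (klFermiPoint μ K₀ θ) -
      (symInterp L (fun k => klLocSelfEnergyRe L M β U μ K₀ (n + 1) k - K₀.eval (latticeMomentum L k))).eval (klFermiPoint μ K₀ θ) =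
      (symInterp L (klLocSelfEnergyRe L M β U μ (fsub K₀ p) (n + 1))).eval (klFermiPoint μ K₀ θ) -
        (symInterp L (klLocSelfEnergyRe L M β U μ K₀ (n + 1))).eval (klFermiPoint μ K₀ θ) + p.eval (klFermiPoint μ K₀ θ) := by
    rw [eval_symInterp_sub L, eval_symInterp_sub L, hfs, eval_symInterp_sub L, eval_symInterp_latticeValues_of_degree_le L p hp]
    ring
  rw [hR, klTwoLegCurveProfile_succ]
  unfold klLocalPart
  ring

/-- The volume guard puts the flow PIECE under the degree guard: `4·klFlowDeg (n+1) ≤ L ⇒ (klFlowPiece n).degree ≤ L/2`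
(`(klFlowPiece n).degree = 2·klFlowDeg n`, `klFlowDeg (n+1) = 4·klFlowDeg n`). -/
theorem degree_klFlowPiece_le_half {β U μ : ℝ} {n : ℕ} (hL : 4 * klFlowDeg (n + 1) ≤ L) :
    (klFlowPiece L M β U μ n).degree ≤ L / 2 := by
  have hdeg : (klFlowPiece L M β U μ n).degree = klFlowDeg n + klFlowDeg n := rfl
  have hsucc : klFlowDeg (n + 1) = 4 * klFlowDeg n := by unfold klFlowDeg; rw [pow_succ]; ring
  rw [hdeg]
  omega

/-- **The flow instance**: `K₀ := K_n`, `p := klFlowPiece n`, `K_{n+1} = K_n ⊖ p`, under the volume guard `4·klFlowDeg (n+1) ≤ L`. -/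
theorem klLocalPart_flow_succ_eq_swap (β U μ : ℝ) {n : ℕ} (hL : 4 * klFlowDeg (n + 1) ≤ L) (θ : ℝ) :
    klLocalPart L M β U μ (klFlowFrameU L M β U μ (n + 1)) (n + 1) θ =
      klTwoLegCurveProfile L M β U μ (klFlowFrameU L M β U μ n) (n + 1) θ +
      ((symInterp L (fun k => klLocSelfEnergyRe L M β U μ (klFlowFrameU L M β U μ (n + 1)) (n + 1) k -
              (klFlowFrameU L M β U μ (n + 1)).eval (latticeMomentum L k))).eval (klFermiPoint μ (klFlowFrameU L M β U μ n) θ) -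
        (symInterp L (fun k => klLocSelfEnergyRe L M β U μ (klFlowFrameU L M β U μ n) (n + 1) k -
              (klFlowFrameU L M β U μ n).eval (latticeMomentum L k))).eval (klFermiPoint μ (klFlowFrameU L M β U μ n) θ)) +
      (((symInterp L (klLocSelfEnergyRe L M β U μ (klFlowFrameU L M β U μ (n + 1)) (n + 1))).eval
              (klFermiPoint μ (klFlowFrameU L M β U μ (n + 1)) θ) +
            (klFlowPiece L M β U μ n).eval (klFermiPoint μ (klFlowFrameU L M β U μ (n + 1)) θ)) -
        ((symInterp L (klLocSelfEnergyRe L M β U μ (klFlowFrameU L M β U μ (n + 1)) (n + 1))).eval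
              (klFermiPoint μ (klFlowFrameU L M β U μ n) θ) +
            (klFlowPiece L M β U μ n).eval (klFermiPoint μ (klFlowFrameU L M β U μ n) θ))) +
      (klLocalPart L M β U μ (klFlowFrameU L M β U μ n) n θ -
        (klFlowPiece L M β U μ n).eval (klFermiPoint μ (klFlowFrameU L M β U μ (n + 1)) θ)) := by
  rw [klFlowFrameU_succ]
  exact klLocalPart_succ_eq_swap β U μ (degree_klFlowPiece_le_half hL) n θ

/-! ## §2 Jets and structured values through the swap -/

/-- **Jets of the last reading from the four swapped brackets** (generic frames): (A′) `TwoLegCurveJetBound … cA cA′ … K₀ (n+1)` and the brackets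
(R), (T), (C1) `C⁴` in `θ` with `|∂_θ^k| ≤ R k, T k, J k` (`k ≤ 4`) ⟹ `θ ↦ ν_{n+1}(K₀ ⊖ p)(θ)` is `C⁴` with
`|∂_θ^k| ≤ curveJetBar cA cA′ U k (n+1) + R k + T k + J k`. -/
theorem readLast_jets_of_swap (β U μ : ℝ) {K₀ p : TrigPolyC4v} (hp : p.degree ≤ L / 2) (n : ℕ) {cA cA' R T J : ℕ → ℝ}
    (hA : TwoLegCurveJetBound L M cA cA' β U μ K₀ (n + 1))
    (hRdiff : ContDiff ℝ 4 fun θ : ℝ =>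
      (symInterp L (fun k => klLocSelfEnergyRe L M β U μ (fsub K₀ p) (n + 1) k - (fsub K₀ p).eval (latticeMomentum L k))).eval
          (klFermiPoint μ K₀ θ) -
        (symInterp L (fun k => klLocSelfEnergyRe L M β U μ K₀ (n + 1) k - K₀.eval (latticeMomentum L k))).eval (klFermiPoint μ K₀ θ))
    (hR : ∀ k ≤ 4, ∀ θ : ℝ, |iteratedDeriv k (fun θ : ℝ =>
      (symInterp L (fun k => klLocSelfEnergyRe L M β U μ (fsub K₀ p) (n + 1) k - (fsub K₀ p).eval (latticeMomentum L k))).eval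
          (klFermiPoint μ K₀ θ) -
        (symInterp L (fun k => klLocSelfEnergyRe L M β U μ K₀ (n + 1) k - K₀.eval (latticeMomentum L k))).eval (klFermiPoint μ K₀ θ)) θ| ≤ R k)
    (hTdiff : ContDiff ℝ 4 fun θ : ℝ =>
      ((symInterp L (klLocSelfEnergyRe L M β U μ (fsub K₀ p) (n + 1))).eval (klFermiPoint μ (fsub K₀ p) θ) +
          p.eval (klFermiPoint μ (fsub K₀ p) θ)) -
        ((symInterp L (klLocSelfEnergyRe L M β U μ (fsub K₀ p) (n + 1))).eval (klFermiPoint μ K₀ θ) + p.eval (klFermiPoint μ K₀ θ)))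
    (hT : ∀ k ≤ 4, ∀ θ : ℝ, |iteratedDeriv k (fun θ : ℝ =>
      ((symInterp L (klLocSelfEnergyRe L M β U μ (fsub K₀ p) (n + 1))).eval (klFermiPoint μ (fsub K₀ p) θ) +
          p.eval (klFermiPoint μ (fsub K₀ p) θ)) -
        ((symInterp L (klLocSelfEnergyRe L M β U μ (fsub K₀ p) (n + 1))).eval (klFermiPoint μ K₀ θ) + p.eval (klFermiPoint μ K₀ θ))) θ| ≤
      T k)
    (hJdiff : ContDiff ℝ 4 fun θ : ℝ => klLocalPart L M β U μ K₀ n θ - p.eval (klFermiPoint μ (fsub K₀ p) θ))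
    (hJ : ∀ k ≤ 4, ∀ θ : ℝ, |iteratedDeriv k (fun θ : ℝ => klLocalPart L M β U μ K₀ n θ - p.eval (klFermiPoint μ (fsub K₀ p) θ)) θ| ≤ J k) :
    ContDiff ℝ 4 (fun θ : ℝ => klLocalPart L M β U μ (fsub K₀ p) (n + 1) θ) ∧
      ∀ k ≤ 4, ∀ θ : ℝ, |iteratedDeriv k (fun θ : ℝ => klLocalPart L M β U μ (fsub K₀ p) (n + 1) θ) θ| ≤
        curveJetBar cA cA' U k (n + 1) + R k + T k + J k := by
  set fA : ℝ → ℝ := klTwoLegCurveProfile L M β U μ K₀ (n + 1) with hfA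
  set fR : ℝ → ℝ := fun θ =>
      (symInterp L (fun k => klLocSelfEnergyRe L M β U μ (fsub K₀ p) (n + 1) k - (fsub K₀ p).eval (latticeMomentum L k))).eval
          (klFermiPoint μ K₀ θ) -
        (symInterp L (fun k => klLocSelfEnergyRe L M β U μ K₀ (n + 1) k - K₀.eval (latticeMomentum L k))).eval (klFermiPoint μ K₀ θ) with hfR
  set fT : ℝ → ℝ := fun θ =>
      ((symInterp L (klLocSelfEnergyRe L M β U μ (fsub K₀ p) (n + 1))).eval (klFermiPoint μ (fsub K₀ p) θ) +
          p.eval (klFermiPoint μ (fsub K₀ p) θ)) -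
        ((symInterp L (klLocSelfEnergyRe L M β U μ (fsub K₀ p) (n + 1))).eval (klFermiPoint μ K₀ θ) + p.eval (klFermiPoint μ K₀ θ)) with hfT
  set fJ : ℝ → ℝ := fun θ => klLocalPart L M β U μ K₀ n θ - p.eval (klFermiPoint μ (fsub K₀ p) θ) with hfJ
  have hsum : (fun θ : ℝ => klLocalPart L M β U μ (fsub K₀ p) (n + 1) θ) = ((fA + fR) + fT) + fJ := by
    funext θ
    simp only [Pi.add_apply, hfA, hfR, hfT, hfJ]
    exact klLocalPart_succ_eq_swap β U μ hp n θ
  rw [hsum]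
  have hAdiff : ContDiff ℝ 4 fA := hA.1
  have hAR : ContDiff ℝ 4 (fA + fR) := hAdiff.add hRdiff
  have hART : ContDiff ℝ 4 (fA + fR + fT) := hAR.add hTdiff
  have hARTJ : ContDiff ℝ 4 (fA + fR + fT + fJ) := hART.add hJdiff
  refine ⟨hARTJ, fun k hk θ => ?_⟩
  have hk' : (k : WithTop ℕ∞) ≤ 4 := by exact_mod_cast hk
  rw [iteratedDeriv_add (hART.contDiffAt.of_le hk') (hJdiff.contDiffAt.of_le hk'),
    iteratedDeriv_add (hAR.contDiffAt.of_le hk') (hTdiff.contDiffAt.of_le hk'),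
    iteratedDeriv_add (hAdiff.contDiffAt.of_le hk') (hRdiff.contDiffAt.of_le hk')]
  calc |iteratedDeriv k fA θ + iteratedDeriv k fR θ + iteratedDeriv k fT θ + iteratedDeriv k fJ θ|
      ≤ |iteratedDeriv k fA θ + iteratedDeriv k fR θ + iteratedDeriv k fT θ| + |iteratedDeriv k fJ θ| := abs_add_le _ _
    _ ≤ (|iteratedDeriv k fA θ + iteratedDeriv k fR θ| + |iteratedDeriv k fT θ|) + |iteratedDeriv k fJ θ| := by
        gcongr; exact abs_add_le _ _
    _ ≤ ((|iteratedDeriv k fA θ| + |iteratedDeriv k fR θ|) + |iteratedDeriv k fT θ|) + |iteratedDeriv k fJ θ| := by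
        gcongr; exact abs_add_le _ _
    _ ≤ curveJetBar cA cA' U k (n + 1) + R k + T k + J k :=
        add_le_add (add_le_add (add_le_add (hA.2 k hk θ) (hR k hk θ)) (hT k hk θ)) (hJ k hk θ)

/-- Four `curveJetBar` tables add. -/
theorem curveJetBar_add_four (a a' r r' t t' j j' : ℕ → ℝ) (U : ℝ) (k n : ℕ) :
    curveJetBar a a' U k n + curveJetBar r r' U k n + curveJetBar t t' U k n + curveJetBar j j' U k n =
      curveJetBar (fun k => a k + r k + t k + j k) (fun k => a' k + r' k + t' k + j' k) U k n := by
  simp only [curveJetBar]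
  ring

/-- **The flow instance in `curveJetBar` currency** — the jets conjunct of stub (C) at `(K_{n+1}, n+1)` from (A′) at `(K_n, n+1)` and the three swapped
brackets with tables `(eR, eR′)`, `(eT, eT′)`, `(eJ, eJ′)` at the allowance scale `n+1`, under the volume guard `4·klFlowDeg (n+1) ≤ L`. -/
theorem readLast_flow_jets_of_swap (β U μ : ℝ) {n : ℕ} (hL : 4 * klFlowDeg (n + 1) ≤ L) {cA cA' eR eR' eT eT' eJ eJ' : ℕ → ℝ}
    (hA : TwoLegCurveJetBound L M cA cA' β U μ (klFlowFrameU L M β U μ n) (n + 1))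
    (hRdiff : ContDiff ℝ 4 fun θ : ℝ =>
      (symInterp L (fun k => klLocSelfEnergyRe L M β U μ (klFlowFrameU L M β U μ (n + 1)) (n + 1) k -
            (klFlowFrameU L M β U μ (n + 1)).eval (latticeMomentum L k))).eval (klFermiPoint μ (klFlowFrameU L M β U μ n) θ) -
        (symInterp L (fun k => klLocSelfEnergyRe L M β U μ (klFlowFrameU L M β U μ n) (n + 1) k -
            (klFlowFrameU L M β U μ n).eval (latticeMomentum L k))).eval (klFermiPoint μ (klFlowFrameU L M β U μ n) θ))
    (hR : ∀ k ≤ 4, ∀ θ : ℝ, |iteratedDeriv k (fun θ : ℝ =>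
      (symInterp L (fun k => klLocSelfEnergyRe L M β U μ (klFlowFrameU L M β U μ (n + 1)) (n + 1) k -
            (klFlowFrameU L M β U μ (n + 1)).eval (latticeMomentum L k))).eval (klFermiPoint μ (klFlowFrameU L M β U μ n) θ) -
        (symInterp L (fun k => klLocSelfEnergyRe L M β U μ (klFlowFrameU L M β U μ n) (n + 1) k -
            (klFlowFrameU L M β U μ n).eval (latticeMomentum L k))).eval (klFermiPoint μ (klFlowFrameU L M β U μ n) θ)) θ| ≤
      curveJetBar eR eR' U k (n + 1))
    (hTdiff : ContDiff ℝ 4 fun θ : ℝ =>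
      ((symInterp L (klLocSelfEnergyRe L M β U μ (klFlowFrameU L M β U μ (n + 1)) (n + 1))).eval
            (klFermiPoint μ (klFlowFrameU L M β U μ (n + 1)) θ) +
          (klFlowPiece L M β U μ n).eval (klFermiPoint μ (klFlowFrameU L M β U μ (n + 1)) θ)) -
        ((symInterp L (klLocSelfEnergyRe L M β U μ (klFlowFrameU L M β U μ (n + 1)) (n + 1))).eval
            (klFermiPoint μ (klFlowFrameU L M β U μ n) θ) +
          (klFlowPiece L M β U μ n).eval (klFermiPoint μ (klFlowFrameU L M β U μ n) θ)))
    (hT : ∀ k ≤ 4, ∀ θ : ℝ, |iteratedDeriv k (fun θ : ℝ =>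
      ((symInterp L (klLocSelfEnergyRe L M β U μ (klFlowFrameU L M β U μ (n + 1)) (n + 1))).eval
            (klFermiPoint μ (klFlowFrameU L M β U μ (n + 1)) θ) +
          (klFlowPiece L M β U μ n).eval (klFermiPoint μ (klFlowFrameU L M β U μ (n + 1)) θ)) -
        ((symInterp L (klLocSelfEnergyRe L M β U μ (klFlowFrameU L M β U μ (n + 1)) (n + 1))).eval
            (klFermiPoint μ (klFlowFrameU L M β U μ n) θ) +
          (klFlowPiece L M β U μ n).eval (klFermiPoint μ (klFlowFrameU L M β U μ n) θ))) θ| ≤ curveJetBar eT eT' U k (n + 1))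
    (hJdiff : ContDiff ℝ 4 fun θ : ℝ => klLocalPart L M β U μ (klFlowFrameU L M β U μ n) n θ -
      (klFlowPiece L M β U μ n).eval (klFermiPoint μ (klFlowFrameU L M β U μ (n + 1)) θ))
    (hJ : ∀ k ≤ 4, ∀ θ : ℝ, |iteratedDeriv k (fun θ : ℝ => klLocalPart L M β U μ (klFlowFrameU L M β U μ n) n θ -
      (klFlowPiece L M β U μ n).eval (klFermiPoint μ (klFlowFrameU L M β U μ (n + 1)) θ)) θ| ≤ curveJetBar eJ eJ' U k (n + 1)) :
    TwoLegReadJetBound L M (fun k => cA k + eR k + eT k + eJ k) (fun k => cA' k + eR' k + eT' k + eJ' k) β U μ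
      (klFlowFrameU L M β U μ (n + 1)) (n + 1) := by
  have hp := degree_klFlowPiece_le_half (L := L) (M := M) (β := β) (U := U) (μ := μ) hL
  rw [klFlowFrameU_succ] at hRdiff hR hTdiff hT hJdiff hJ ⊢
  obtain ⟨hdiff, hle⟩ := readLast_jets_of_swap β U μ hp n hA hRdiff hR hTdiff hT hJdiff hJ
  refine ⟨hdiff, fun k hk θ => (hle k hk θ).trans (le_of_eq ?_)⟩
  exact curveJetBar_add_four cA cA' eR eR' eT eT' eJ eJ' U k (n + 1)

/-- **Structured values add through the swap**: if `|δ_{n+1}(K₀)(θ) − τ_A| ≤ a`, `|(R)(θ) − τ_R| ≤ r`, `|(T)(θ) − τ_T| ≤ t`, `|(C1)(θ) − τ_J| ≤ j`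
for all `θ`, then `|ν_{n+1}(K₀ ⊖ p)(θ) − (τ_A + τ_R + τ_T + τ_J)| ≤ a + r + t + j` (the mean-free / Osc conjunct's input shape). -/
theorem readLast_structured_of_swap (β U μ : ℝ) {K₀ p : TrigPolyC4v} (hp : p.degree ≤ L / 2) (n : ℕ) {τA τR τT τJ a r t j : ℝ}
    (hA : ∀ θ : ℝ, |klTwoLegCurveProfile L M β U μ K₀ (n + 1) θ - τA| ≤ a)
    (hR : ∀ θ : ℝ, |(symInterp L (fun k => klLocSelfEnergyRe L M β U μ (fsub K₀ p) (n + 1) k - (fsub K₀ p).eval (latticeMomentum L k))).eval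
          (klFermiPoint μ K₀ θ) -
        (symInterp L (fun k => klLocSelfEnergyRe L M β U μ K₀ (n + 1) k - K₀.eval (latticeMomentum L k))).eval (klFermiPoint μ K₀ θ) - τR| ≤ r)
    (hT : ∀ θ : ℝ, |((symInterp L (klLocSelfEnergyRe L M β U μ (fsub K₀ p) (n + 1))).eval (klFermiPoint μ (fsub K₀ p) θ) +
          p.eval (klFermiPoint μ (fsub K₀ p) θ)) -
        ((symInterp L (klLocSelfEnergyRe L M β U μ (fsub K₀ p) (n + 1))).eval (klFermiPoint μ K₀ θ) + p.eval (klFermiPoint μ K₀ θ)) - τT| ≤ t)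
    (hJ : ∀ θ : ℝ, |klLocalPart L M β U μ K₀ n θ - p.eval (klFermiPoint μ (fsub K₀ p) θ) - τJ| ≤ j) (θ : ℝ) :
    |klLocalPart L M β U μ (fsub K₀ p) (n + 1) θ - (τA + τR + τT + τJ)| ≤ a + r + t + j := by
  rw [klLocalPart_succ_eq_swap β U μ hp n θ]
  have h1 := hA θ; have h2 := hR θ; have h3 := hT θ; have h4 := hJ θ
  rw [abs_le] at h1 h2 h3 h4 ⊢
  constructor <;> linarith [h1.1, h1.2, h2.1, h2.2, h3.1, h3.2, h4.1, h4.2]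

end Model

end Summit.HubbardSuperconductivity.HubbardSuperconductivity.Theorems.KLRegimeSplit

end
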